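import Summits.NavierStokesRegularity.NavierStokesRegularity.Theses.FilamentSkeletonRss
import Literature.Analysis.FluidPDE.AncientMildDrift

/-!
# `RdssProfileTruncation` (stmt-NavierStokesRegularity-11289): the SPACE part of the Type-I bound is load-bearing

Negative-side support for crux `RdssProfileTruncation` of routes `FilamentSkeletonRss` (#4) and
`CorkscrewDynamo` (#3) (cdisprove seat, cycle 1, 2026-08-16; crux workfile
`Cruxes/RdssProfileTruncation/Disproof.lean`).  The crux is the bridge
"nontrivial Type-I rotated-DSS ancient mild solution ⇒ finite-time blow-up of a Leray–Hopf classical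
solution from a rapidly decaying datum (X5a)".  Kernel-checked facts for provers and planners:

* `rdssProfileTruncation_timeDecayOnly_antecedent_inhabited` — if the Type-I bound
  `‖u(t,x)‖ ≤ C₀/(‖x‖ + √(−t))` (`HasTypeIDecay`) is weakened to the blow-up RATE
  `‖u(t,x)‖ ≤ C₀/√(−t)` (`HasTypeITimeDecay`), the antecedent of the bridge is inhabited by KNSS's
  parasitic drift `u(t,x) = (√(−t))⁻¹ e₀` (pressure `−½(−t)^{−3/2} x₁`; Koch–Nadirashvili–Seregin–
  Šverák 2009, §1 p. 3): an ancient mild solution of the duality-form class (in-tree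
  `isAncientMildSolution_timeConst`), constant measurable slices, `(2, id)`-RDSS, Type-I in time with
  `C₀ = 1`, nonzero on every slice — and NOT Type-I in space for any constant.
* `rdssProfileTruncation_timeDecayOnly_iff`, `rdssProfileTruncation_withoutTypeI_iff` — hence the
  bridge with the weakened (resp. deleted) Type-I clause is EQUIVALENT to its own conclusion X5a, the
  open blow-up problem: any proof of the crux must use the spatial decay `C₀/(‖x‖ + √(−t))` of the
  profile, not merely its blow-up rate.  (The weakened bridge trivially implies the crux, since
  space-time Type-I implies Type-I in time for the positive constants witnesses carry.)
-/

set_option linter.dupNamespace false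

noncomputable section

namespace Summit.NavierStokesRegularity.NavierStokesRegularity.Theorems.RdssProfileTruncation.Negative

open Literature.Analysis.FluidPDE MeasureTheory

/-- **KNSS's parasitic drift inhabits the time-decay-only antecedent, and is not Type-I in space.**
Witness `c = 2`, `R = id`, `u(t, x) = (√(−t))⁻¹ e₀` (junk `0` for `t ≥ 0`).
[cite: KochNadirashviliSereginSverak2009, §1 p. 3 (parasitic solutions u(x,t) = b(t))] -/
theorem rdssProfileTruncation_timeDecayOnly_antecedent_inhabited :
    ∃ (c : ℝ) (R : (EuclideanSpace ℝ (Fin 3)) ≃ₗᵢ[ℝ] (EuclideanSpace ℝ (Fin 3))) (u : ℝ → (EuclideanSpace ℝ (Fin 3)) → (EuclideanSpace ℝ (Fin 3))), 1 < c ∧ IsAncientMildSolution 1 u ∧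
      (∀ t < 0, AEStronglyMeasurable (u t) volume) ∧ IsRotatedDSS c R u ∧
      (∃ C₀ : ℝ, HasTypeITimeDecay C₀ u) ∧ (∀ C₀ : ℝ, ¬ HasTypeIDecay C₀ u) ∧
      ¬ (∀ t < 0, u t =ᵐ[volume] 0) := by
  set e₀ : (EuclideanSpace ℝ (Fin 3)) := EuclideanSpace.single 0 1 with he₀
  have hne : ‖e₀‖ = 1 := by simp [he₀]
  have he0 : e₀ ≠ 0 := by
    intro h; rw [h, norm_zero] at hne; exact zero_ne_one hne
  have hsqrt : ∀ t : ℝ, Real.sqrt (-((2 : ℝ) ^ 2 * t)) = 2 * Real.sqrt (-t) := fun t => by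
    rw [show -((2 : ℝ) ^ 2 * t) = 2 ^ 2 * (-t) by ring, Real.sqrt_mul (by norm_num) (-t),
      Real.sqrt_sq (by norm_num)]
  refine ⟨2, LinearIsometryEquiv.refl ℝ (EuclideanSpace ℝ (Fin 3)), fun t _ => (Real.sqrt (-t))⁻¹ • e₀, one_lt_two,
    isAncientMildSolution_timeConst 1 fun t => (Real.sqrt (-t))⁻¹ • e₀,
    fun t _ => aestronglyMeasurable_const, fun t x => ?_, ⟨1, fun t ht x => ?_⟩, fun C₀ hC => ?_, ?_⟩
  · -- `(2, id)`-RDSS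
    simp only [show (LinearIsometryEquiv.refl ℝ (EuclideanSpace ℝ (Fin 3))).symm = LinearIsometryEquiv.refl ℝ (EuclideanSpace ℝ (Fin 3)) from rfl,
      LinearIsometryEquiv.coe_refl, id_eq, hsqrt]
    module
  · -- Type-I in time, constant `1`
    have hs : 0 < Real.sqrt (-t) := Real.sqrt_pos.2 (by linarith)
    simp only [norm_smul, norm_inv, Real.norm_of_nonneg hs.le, hne, mul_one, one_div, le_refl]
  · -- not Type-I in space: test `t = -1`, `x = (|C₀| + 1) e₀`
    have key := hC (-1) (by norm_num) ((|C₀| + 1) • e₀)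
    have hn : ‖(|C₀| + 1) • e₀‖ = |C₀| + 1 := by
      rw [norm_smul, hne, mul_one, Real.norm_of_nonneg (by positivity)]
    simp only [neg_neg, Real.sqrt_one, inv_one, one_smul, hne, hn] at key
    rw [le_div_iff₀ (by positivity : (0 : ℝ) < |C₀| + 1 + 1)] at key
    linarith [le_abs_self C₀]
  · -- nonzero on the slice `t = -1`
    intro h
    have h1 := h (-1) (by norm_num)
    have heq := (Continuous.ae_eq_iff_eq volume continuous_const continuous_const).1 h1
    have := congr_fun heq 0
    simp [he0] at this

/-- **Weakening Type-I to Type-I-in-time collapses the bridge to the blow-up problem X5a itself**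
(the conclusion is `RdssProfileTruncation`'s, verbatim). [folklore] -/
theorem rdssProfileTruncation_timeDecayOnly_iff :
    ((∃ (c : ℝ) (R : (EuclideanSpace ℝ (Fin 3)) ≃ₗᵢ[ℝ] (EuclideanSpace ℝ (Fin 3))) (u : ℝ → (EuclideanSpace ℝ (Fin 3)) → (EuclideanSpace ℝ (Fin 3))), 1 < c ∧ IsAncientMildSolution 1 u ∧
        (∀ t < 0, AEStronglyMeasurable (u t) volume) ∧ IsRotatedDSS c R u ∧
        (∃ C₀ : ℝ, HasTypeITimeDecay C₀ u) ∧ ¬ (∀ t < 0, u t =ᵐ[volume] 0)) →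
      ∃ ν : ℝ, 0 < ν ∧ ∃ T : ℝ, 0 < T ∧ ∃ (u : ℝ → (EuclideanSpace ℝ (Fin 3)) → (EuclideanSpace ℝ (Fin 3))) (p : ℝ → (EuclideanSpace ℝ (Fin 3)) → ℝ),
        IsMaximalSmoothSolution ν 0 u p T ∧ IsLerayHopfOn T ν 0 (u 0) u ∧
        HasRapidSpatialDecay (u 0)) ↔
    ∃ ν : ℝ, 0 < ν ∧ ∃ T : ℝ, 0 < T ∧ ∃ (u : ℝ → (EuclideanSpace ℝ (Fin 3)) → (EuclideanSpace ℝ (Fin 3))) (p : ℝ → (EuclideanSpace ℝ (Fin 3)) → ℝ),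
      IsMaximalSmoothSolution ν 0 u p T ∧ IsLerayHopfOn T ν 0 (u 0) u ∧
      HasRapidSpatialDecay (u 0) := by
  refine ⟨fun h => ?_, fun h _ => h⟩
  obtain ⟨c, R, u, hc, hm, hmeas, hdss, hC, -, hnz⟩ :=
    rdssProfileTruncation_timeDecayOnly_antecedent_inhabited
  exact h ⟨c, R, u, hc, hm, hmeas, hdss, hC, hnz⟩

/-- **Deleting the Type-I clause collapses the bridge to X5a** (same drift witness). [folklore] -/
theorem rdssProfileTruncation_withoutTypeI_iff :
    ((∃ (c : ℝ) (R : (EuclideanSpace ℝ (Fin 3)) ≃ₗᵢ[ℝ] (EuclideanSpace ℝ (Fin 3))) (u : ℝ → (EuclideanSpace ℝ (Fin 3)) → (EuclideanSpace ℝ (Fin 3))), 1 < c ∧ IsAncientMildSolution 1 u ∧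
        (∀ t < 0, AEStronglyMeasurable (u t) volume) ∧ IsRotatedDSS c R u ∧
        ¬ (∀ t < 0, u t =ᵐ[volume] 0)) →
      ∃ ν : ℝ, 0 < ν ∧ ∃ T : ℝ, 0 < T ∧ ∃ (u : ℝ → (EuclideanSpace ℝ (Fin 3)) → (EuclideanSpace ℝ (Fin 3))) (p : ℝ → (EuclideanSpace ℝ (Fin 3)) → ℝ),
        IsMaximalSmoothSolution ν 0 u p T ∧ IsLerayHopfOn T ν 0 (u 0) u ∧
        HasRapidSpatialDecay (u 0)) ↔
    ∃ ν : ℝ, 0 < ν ∧ ∃ T : ℝ, 0 < T ∧ ∃ (u : ℝ → (EuclideanSpace ℝ (Fin 3)) → (EuclideanSpace ℝ (Fin 3))) (p : ℝ → (EuclideanSpace ℝ (Fin 3)) → ℝ),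
      IsMaximalSmoothSolution ν 0 u p T ∧ IsLerayHopfOn T ν 0 (u 0) u ∧
      HasRapidSpatialDecay (u 0) := by
  refine ⟨fun h => ?_, fun h _ => h⟩
  obtain ⟨c, R, u, hc, hm, hmeas, hdss, -, -, hnz⟩ :=
    rdssProfileTruncation_timeDecayOnly_antecedent_inhabited
  exact h ⟨c, R, u, hc, hm, hmeas, hdss, hnz⟩

end Summit.NavierStokesRegularity.NavierStokesRegularity.Theorems.RdssProfileTruncation.Negative
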